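import Literature.MathematicalPhysics.QuantumFieldTheory.Balaban1983to89.B15
import Literature.MathematicalPhysics.QuantumFieldTheory.Balaban1983to89.B15Sect1Instances
import Literature.MathematicalPhysics.QuantumFieldTheory.Balaban1983to89.B15Eq177GaugeInvariance
import Literature.MathematicalPhysics.QuantumFieldTheory.Balaban1983to89.B14Eq12InteriorLocality

/-!
# `Balaban1983to89.B15Prop1Carrier` — T. Bałaban, *Large field renormalization. I. The basic step of the 𝐑 operation*,
# Commun. Math. Phys. **122** (1989) 175–202 [Balaban1989LargeFieldI] = «[IV]», **Proposition 1** p. 194 and (1.77)–(1.78):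
# THE CARRIER OF PROPOSITION 1 AS PRINTED — the group of gauge transformations *"defined on Λ"*, its ORBITS in the variables
# `V_k↾_Λ` of the function (1.77), *"critical orbit"* (through the exponential chart `V′ = exp iB′` of the printed proof,
# [Balaban1989LargeFieldII] p. 359), *"a minimum of the function"*, the deviation `sup_{p′∈Λ} |V_Λ(∂p′) − 1|` of (1.78), and the
# hypothesis *"|∂V_k − 1| < ε on the domain Z ∩ Λᶜ"* — as CONCRETE objects over the `Setup` lattices, assembled into an
# `LF : B15.LFVar` OF PRINT — of record `lfVarOn` (v1.1, with the DOMAIN of (1.77); v1's `lfVar` is the `dom = ⊤` reading), with the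
# statement of record `B15.Prop1Printed` UNFOLDED at it (`prop1Printed_lfVarOn_iff`; `prop1Printed_lfVar_iff` for the `dom = ⊤` reading)

statement-level skeleton of published theorems with citation tags; proofs where landed; nothing here is a claim about
the Yang–Mills mass gap

PDF held: `paper:balaban1989-cmp122-large-field-i` (journal page = PDF page + 174); pp. 193–195 [PDF 19–21] READ AS IMAGES by
this seat on the ×2 renders `run/shared/lean/pub/pub-balaban/b2b-balaban-ref1/pages/1989-cmp122-large-field-I/1989-cmp122-large-
field-I-p019-x2.png`, `…-p020-x2.png` and on the text layer `p0021.txt`; [LF-II] = T. Bałaban, *Large field renormalization. II.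
Localization, exponentiation, and bounds for the 𝐑 operation*, Commun. Math. Phys. **122** (1989) 355–392
[Balaban1989LargeFieldII], `paper:balaban1989-cmp122-large-field-ii` (journal page = PDF page + 354), p. 359 [PDF 5] text layer.

CITATION HEADER / WHAT IS REPRODUCED (mega-formalization `lit-balaban`, HOME `run/shared/lean/pub/lit-balaban/`; seat
`lit-balaban-type-B15` = the R141 (B) literature TYPER of DAG node N12; dag-lead FAN-OUT v1.1 §N12 s1 *«PROP 1 INHABITED … FIRST
MISSING ESTIMATE = Prop 1 at the W-pinned record»*).  SKELETON row served: **B15.Prop1** (cells; head unchanged): the statement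
of record `B15.Prop1Printed` (r2, `B15.lean` :128) quantifies over an ABSTRACT carrier `B15.LFVar` (instances, boundary data,
orbits, `Regular`, `IsCritical`, `IsMinimum`, `dev`, `AnalyticExt` as free types and predicates); it is INHABITED on every
carrier realised by the Hilbert model of the [LF-II] p. 359 proof (n12-b `B15Prop1FromModel.prop1Printed_of_model`, p408851);
the function (1.77) and its minimiser are concrete (r12 `B15DeterminingSets.fun177` ∕ `IsVLambda`, r11
`B15Sect1Instances.fun177std` ∕ `IsVLambdaStd`, `B15Eq177GaugeInvariance.fun177_gaugeAct` ∕ `isVLambda_gaugeAct`).  What NO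
file constructed (tree `grep LFVar`, 2026-08-26: parameters only, plus the junk witness of
`Node00.CarriersW.not_b15Leaf_WOfRecord₁₀_swapLF`): an `LFVar` whose fields ARE print's objects — the carrier NODE 00's [IV]
pin leaves RESIDUAL (`Node00.CarriersW.ResidW.LF`, *«a pin of `LF` by objects must precede any ∀-form booking of N12»*).
This file supplies it.

THE PRINT.  p. 194 [PDF 20], verbatim: *"Consider the function V_k↾_Λ → A(U_{k,Z}(V_k)). (1.77) It is defined on
configurations V_k satisfying mild regularity conditions, e.g., |∂V_k − 1| < a₁ on Z. The function is invariant with respect to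
the group of all gauge transformations defined on Λ, hence it is natural to consider it on orbits of this group. We look for a
minimal orbit. We will prove later the following theorem.  **Proposition 1.** For a configuration V_k↾_{Z∩Λᶜ}, satisfying the
regularity condition |∂V_k − 1| < ε on the domain Z ∩ Λᶜ, for ε > 0 sufficiently small, there exists exactly one critical orbit
of the function (1.77). An element of the orbit is a minimum of the function, and is denoted by V_Λ = V_Λ(V_k↾_{Z∩Λᶜ}). It
satisfies the regularity condition |V_Λ(∂p′) − 1| < B₅M⁵ε for p′ ∈ Λ. (1.78)  The orbit-valued function V_Λ(V_k↾_{Z∩Λᶜ}) has an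
analytic extension for Gᶜ-valued configurations 𝕍_k = V′_kV_k = exp iB′V_k satisfying the same regularity condition as V_k, with
B′ ∈ 𝔤ᶜ and small, e.g., |B′| < ε."*  p. 195 [PDF 21]: *"The constant B₅ is determined by the geometry of the problem, more
precisely by the condition (i). The power M⁵ is not the optimal one, in fact we can take just M, but we will not prove it.
Extend the function V_Λ on the whole domain Z putting V_Λ = V_k on Z ∩ Λᶜ"*.  p. 193 [PDF 19] (the form of the hypothesis):
*"Take a configuration V_k defined on Z ∩ Λᶜ and satisfying the regularity condition |V_k(∂p′) − 1| < ε for p′ ⊂ Z ∩ Λᶜ, ε > 0 is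
sufficiently small."*; p. 195: *"Let us recall that according to our convention, bonds intersecting ∂Λ belong to 𝔹₀"*.
[LF-II] p. 359 [PDF 5] (the only printed proof; the meaning of *"critical"*): *"we consider the variational problem for the
function V′↾_Λ → A(U_{k,Z}(V′V_k)), where V′ satisfies mild regularity conditions. Fixing the gauge G₀ for V′ we get a small
configuration, and we can write V′ = exp iB′. We expand the function with respect to B′ … Now the condition for a critical
configuration is the equation ⟨δB′, H*_{1,k}J_{k,Z}⟩ + ⟨δB′, H*_{1,k}Δ₁H_{1,k}B′⟩ + ⟨δB′, H*_{1,k}((δ/δA)V)(H_{1,k}B′)⟩ = 0 (1.12)"*.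

WHAT IS DEFINED ∕ PROVED (definitions WITH BODIES + kernel API; Mathlib + the four imports; no `sorry`, no `… : Prop` fact,
no `instance`, no `notation`, no new axiom).
§1 `IsGaugeOn S u` — a gauge transformation of `T^{(k)}` *"defined on Λ"*: `u = 1` off `S = Λ^{(k)}`; closed under `1`, products
   (`B16Sect1Backgrounds.mulG`) and inverses (`invG`).
§2 `orbit S V = {V^u : u defined on S}`, its class structure (`mem_orbit_self`, `mem_orbit_comm`, `orbit_eq_of_mem`), the ORBIT
   SPACE `OrbitSp G S` (a subtype of `Set (GaugeField P k G)`) and `orbitOf`.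
§3 `extSet Λb V_k` — the variables of (1.77): configurations equal to `V_k` off the bonds `Λb` MEETING `Λ^{(k)}` (r11's
   `B15Sect1Instances.Ext175` as a set; p. 195 bond convention); a Λ-orbit through such a configuration stays inside
   (`orbit_subset_extSet`, from r11's `gaugeAct_eq_of_not_mem`).
§4 `plaqsInside X` — the plaquettes `p′ ⊂ X` (all four corners in `X`; p. 193 *"p′ ⊂ Z ∩ Λᶜ"*), versus the p. 77 [14] ∕ p. 251
   [I] convention `B8Eq17ClassAkV1.plaqsOf` (*"p′ ∈ Λ"* of (1.78): a corner in `Λ`); the hypothesis of Proposition 1,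
   `Setup.PlaqSmallOn (plaqsInside (Z∩Λᶜ)^{(k)}) ε`, depends on `V_k↾_{Z∩Λᶜ}` only (`plaqSmallOn_inside_congr`, through
   `B14.Eq12InteriorLocality.plaqHol_congr`).
§5 `orbitDev Λp O = sup {|V(∂p′) − 1| : V ∈ O, p′ ∈ Λp}` — the deviation of (1.78) read on the ORBIT (`dist1 ∘ plaqHol` is
   constant along gauge orbits, `dist1_plaqHol_gaugeAct`); `le_orbitDev`, `orbitDev_lt_of_forall` (finite range).
§6 `IsCriticalPt ch Λb f V` — CRITICAL CONFIGURATION of a function `f` of the variables `V_k↾_Λ` through an exponential chart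
   `ch : B16Sect1Backgrounds.ExpChart G 𝔤` ([LF-II] p. 359 *"V′ = exp iB′ … the condition for a critical configuration"*): every
   one-parameter variation `s ↦ f((exp isA)·V)`, `A` supported on `Λb`, has derivative `0` at `s = 0`; such variations stay among
   the variables (`expMul_smul_mem_extSet`); a minimum is critical whenever the variations are differentiable
   (`IsMinPt.isCriticalPt`, Fermat); criticality passes along Λ-orbits of an invariant `f` when the chart is Ad-covariant
   (`IsCriticalPt.gaugeAct_of_adCov`, the covariance DISPLAYED as a hypothesis).
§7 `IsMinPt Λb f V_k V` — *"a minimum of the function"* over the variables (= r12's `IsVLambda` for a general `f`, `Iff.rfl`: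
   `isVLambda_iff_isMinPt`); passes along Λ-orbits of an invariant `f` (`IsMinPt.gaugeAct`).
§8 **THE CARRIER OF PRINT**: `Inst P G` (the step `k`, the regions `Z ⊇ Λ` of `T_η`, the cube size `M`, the function (1.77) `f`, and
   the analytic-extension clause `An` CARRIED AS DATA exactly as `B15.LFVar.AnalyticExt` — HONEST SCOPE (i) below),
   **`lfVar ch I : B15.LFVar`** for a family of instances `I : ι → Inst P G`, and **`prop1Printed_lfVar_iff`**: `B15.Prop1Printed
   (lfVar ch I)` UNFOLDED into the lattice sentence (the statement N12's provers must inhabit at the record), with the corollary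
   `exists_minimizer_of_prop1Printed` ((1.78) for the element `V_Λ`: a minimiser over the variables with `|V_Λ(∂p′) − 1| < B₅M⁵ε`
   for every `p′ ∈ Λ`).
§9 PRINT'S INSTANCE `Inst.std bg M₁ Z Λ k M An` (`f :=` r11's `fun177std bg M₁ Z k` = `A(U_{k,Z}(V_k))`, (1.74) ∘ Wilson action):
   `isMinPt_std_iff` (= r11's `IsVLambdaStd`, `Iff.rfl`), `IsMinPt.std_gaugeAct` (r11's `isVLambda_gaugeAct` over the [15] (181)
   covariance `Cov181`), `isMinimum_std_iff_forall` (at print's instance, over (181), *"an element of the orbit is a minimum"* ⟺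
   every element is).

HONEST SCOPE (located, nothing repaired; count-neutral).  (i) The ANALYTIC-EXTENSION clause of Proposition 1 (*"The orbit-valued
function V_Λ(V_k↾_{Z∩Λᶜ}) has an analytic extension for Gᶜ-valued configurations"*) is NOT modelled: it is the datum `Inst.An`,
read verbatim into `LFVar.AnalyticExt`, exactly as r2's abstract carrier does; its only typed model is the complex twin
`B16Prop1IVFromProp4.prop1IV_of_ineq19_prop4` (r13).  A consumer who instantiates `An` by `True` weakens Proposition 1 visibly.
(ii) *"critical orbit"*: typed as *an orbit inside the variables containing a critical configuration* (`∃ V ∈ O`), which is what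
the p. 359 proof delivers (the G₀-gauge-fixed representative solves (1.12)); that EVERY element of the orbit is then critical needs
the Ad-covariance of the chart (`IsCriticalPt.gaugeAct_of_adCov`) — true for the matrix exponential, not assumed of the abstract
`ExpChart`.  (iii) The chart `ch` is DATA (`Setup.GaugeGroup` fixes no matrix model, DIVERGENCE F4); differentiability of the
variations is a hypothesis where used (`IsMinPt.isCriticalPt`), never asserted.  (iv) *"for p′ ∈ Λ"* in (1.78) is read by the
tree's convention of record `plaqsOf` (a corner in `Λ^{(k)}`; [14] p. 77, [I] p. 251); the hypothesis *"p′ ⊂ Z ∩ Λᶜ"* (p. 193) by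
`plaqsInside`; the two plaquette classes partition the plaquettes meeting `Z` near `Λ` (`mem_plaqsInside_compl_iff`).  (v) `M` is
the instance's letter (p. 195 *"determined by the geometry of the problem"*; [LF-II] p. 358 *"Λ … contained in a cube of the size
100M"*) — no relation between `M` and `Λ` is typed here.  (vi) Nothing of Proposition 1 is asserted: `lfVar` is a carrier,
`prop1Printed_lfVar_iff` an `Iff`; inhabiting `B15.Prop1Printed (lfVar ch I)` at NODE 00's objects is the N12 provers' ∕
node00-def's act (n12-b's dictionary (d1)–(d4) of `prop1Printed_of_model` is stated over exactly these predicates).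

v1.1 (same seat, same day; APPEND-ONLY — every v1 declaration byte-identical; §10–§11 added).  THE DOMAIN OF (1.77) — THE READING
OF RECORD.  Print gives the function (1.77) a DOMAIN: p. 194 *"It is defined on configurations V_k satisfying mild regularity
conditions, e.g., |∂V_k − 1| < a₁ on Z"*, [LF-II] p. 359 *"where V′ satisfies mild regularity conditions. Fixing the gauge G₀ for V′
we get a small configuration"*; *"exactly one critical orbit of the function (1.77)"* and *"a minimum of the function"* range over
orbits ∕ configurations IN THAT DOMAIN.  v1's `lfVar` is the `dom = ⊤` reading: its uniqueness clause ranges over EVERY Λ-orbit of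
extensions of `V_k` (the configuration space of the variables is a product of copies of `G`; for compact `G` a smooth invariant
`f` has there, besides a minimum, the orbit of a MAXIMUM, critical as well) — on that clause `lfVar` is typed STRONGER than
print (LOCATED by this seat; n12-b's HONEST SCOPE (ii) of `B15Prop1FromModel` is the same point seen from the model).  §10
`IsMinPtOn X f V` (minimum over a set of configurations; `isMinPt_iff_isMinPtOn`), print's example domain `domReg Z k a₁ =
{V : |V(∂p) − 1| < a₁ for p ⊂ Z}` (gauge invariant: `gaugeAct_mem_domReg`, `orbit_subset_domReg`), `IsMinPtOn.gaugeAct_inter`,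
`exists_isMinPtOn_iff_forall`; §11 `InstOn` (= `Inst` + `dom`), **`lfVarOn ch I`** (`IsCritical i V_k O := O ⊆ extSet ∩ dom ∧
∃ V ∈ O` critical; `IsMinimum := ∃ V ∈ O, IsMinPtOn (extSet ∩ dom) f V`; the other fields as `lfVar`), **`prop1Printed_lfVarOn_iff`**
(`Iff.rfl`) — THE CARRIER AND SENTENCE OF RECORD —, `exists_minimizerOn_of_prop1Printed`, `devOn_lt_of_mem`, `regularOn_congr`,
`InstOn.std bg M₁ Z Λ k M a₁ An` (`dom := domReg Z k a₁`), `isMinimumOn_std_iff_forall`; §12 `isCriticalPt_of_forall_hasDerivAt`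
(junction with r13's `B16Sect1AnalyticExt.ExtData.IsCritAt`, criticality along EVERY chart direction, [LF-II] (1.39)).  `lfVar` is kept as the `dom = ⊤`
special reading (nothing imports it yet but the bus named it; not deleted, append-only).

v1.2 DOC-ONLY (same seat, same day; referee-reader ref-3 advisory N-g117-1): the title line and the docstrings of `lfVar` ∕
`prop1Printed_lfVar_iff` now say *`dom = ⊤` reading* instead of *as printed* and point to `lfVarOn` ∕ `prop1Printed_lfVarOn_iff` as the
carrier ∕ sentence OF RECORD; every declaration byte-identical to v1.1 (kernel confirmation of the located point by dag-n12-c: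
`B15Prop1CarrierDomain.not_prop1Printed_lfVar_of_compact` ∕ `not_prop1Printed_lfVarOn_of_two_critical`, p457364).
-/

noncomputable section

open Set

namespace Literature.MathematicalPhysics.QuantumFieldTheory.Balaban1983to89.B15Prop1Carrier

open Literature.MathematicalPhysics.QuantumFieldTheory.Balaban1983to89
open B15DeterminingSets B14.Eq213DetSet B14.Eq216Concrete B8Eq17ClassAkV1 GaugeField
open Literature.MathematicalPhysics.QuantumFieldTheory.BalabanImbrieJaffe1984to88.BIJ85Eq453GaugeField
open B16Sect1Backgrounds B14.Eq12InteriorLocality B15Sect1Instances B15Eq177GaugeInvariance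

variable {P : Params}

/-! ## §1 The group of gauge transformations *"defined on Λ"* (p. 194) -/

section GaugeOn

variable {G : Type*} [GaugeGroup G] {k : ℕ}

/-- p. 194, verbatim: *"The function is invariant with respect to the group of all gauge transformations defined on Λ"* — a gauge
transformation `u` of `T^{(k)}` DEFINED ON the site set `S` (print: `S = Λ^{(k)}`): `u(y) = 1` for `y ∉ S`.
[cite: Balaban1989LargeFieldI, (1.77) p.194] -/
def IsGaugeOn (S : Set (Site P k)) (u : GaugeTransf P k G) : Prop := ∀ y, y ∉ S → u y = 1

/-- The identity transformation is defined on every `S`. [cite: Balaban1989LargeFieldI, (1.77) p.194] -/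
theorem isGaugeOn_one (S : Set (Site P k)) : IsGaugeOn S (fun _ : Site P k => (1 : G)) := fun _ _ => rfl

/-- Products of transformations defined on `S` are defined on `S` (*"the group of all gauge transformations defined on Λ"*).
[cite: Balaban1989LargeFieldI, (1.77) p.194] -/
theorem IsGaugeOn.mul {S : Set (Site P k)} {u v : GaugeTransf P k G} (hu : IsGaugeOn S u) (hv : IsGaugeOn S v) :
    IsGaugeOn S (mulG u v) := fun y hy => by rw [mulG, hu y hy, hv y hy, mul_one]

/-- Inverses of transformations defined on `S` are defined on `S`. [cite: Balaban1989LargeFieldI, (1.77) p.194] -/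
theorem IsGaugeOn.inv {S : Set (Site P k)} {u : GaugeTransf P k G} (hu : IsGaugeOn S u) : IsGaugeOn S (invG u) :=
  fun y hy => by rw [invG, hu y hy, inv_one]

/-- Monotonicity in the site set. [cite: Balaban1989LargeFieldI, (1.77) p.194] -/
theorem IsGaugeOn.mono {S T : Set (Site P k)} (hST : S ⊆ T) {u : GaugeTransf P k G} (hu : IsGaugeOn S u) :
    IsGaugeOn T u := fun y hy => hu y fun h => hy (hST h)

/-- `U^1 = U`. [cite: Balaban1985Averaging, (8) p.19] -/
theorem gaugeAct_one_fun (U : GaugeField P k G) : gaugeAct (fun _ : Site P k => (1 : G)) U = U := by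
  funext b; simp [gaugeAct]

/-- `(U^u)^{u⁻¹} = U`. [cite: Balaban1985Averaging, (8) p.19] -/
theorem gaugeAct_invG_gaugeAct (u : GaugeTransf P k G) (U : GaugeField P k G) : gaugeAct (invG u) (gaugeAct u U) = U := by
  rw [gaugeAct_gaugeAct]
  have : mulG (invG u) u = fun _ => (1 : G) := by funext y; simp [mulG, invG]
  rw [this, gaugeAct_one_fun]

end GaugeOn

/-! ## §2 Orbits of the Λ-gauge group and the orbit space -/

section Orbits

variable {G : Type*} [GaugeGroup G] {k : ℕ}

/-- p. 194: *"hence it is natural to consider it on orbits of this group"* — the ORBIT of a configuration `V` of `T^{(k)}` under the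
gauge transformations defined on `S`: `{V^u : u = 1 off S}`. [cite: Balaban1989LargeFieldI, (1.77) p.194] -/
def orbit (S : Set (Site P k)) (V : GaugeField P k G) : Set (GaugeField P k G) :=
  {W | ∃ u : GaugeTransf P k G, IsGaugeOn S u ∧ W = gaugeAct u V}

/-- Membership in an orbit, unfolded. [cite: Balaban1989LargeFieldI, (1.77) p.194] -/
theorem mem_orbit_iff {S : Set (Site P k)} {V W : GaugeField P k G} :
    W ∈ orbit S V ↔ ∃ u : GaugeTransf P k G, IsGaugeOn S u ∧ W = gaugeAct u V := Iff.rfl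

/-- Every configuration lies on its own orbit. [cite: Balaban1989LargeFieldI, (1.77) p.194] -/
theorem mem_orbit_self (S : Set (Site P k)) (V : GaugeField P k G) : V ∈ orbit S V :=
  ⟨fun _ => 1, isGaugeOn_one S, (gaugeAct_one_fun V).symm⟩

/-- `V^u` lies on the orbit of `V` for `u` defined on `S`. [cite: Balaban1989LargeFieldI, (1.77) p.194] -/
theorem gaugeAct_mem_orbit {S : Set (Site P k)} {u : GaugeTransf P k G} (hu : IsGaugeOn S u) (V : GaugeField P k G) :
    gaugeAct u V ∈ orbit S V := ⟨u, hu, rfl⟩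

/-- Orbits are symmetric (inverse transformation). [cite: Balaban1989LargeFieldI, (1.77) p.194] -/
theorem mem_orbit_comm {S : Set (Site P k)} {V W : GaugeField P k G} : W ∈ orbit S V ↔ V ∈ orbit S W := by
  constructor
  · rintro ⟨u, hu, rfl⟩
    exact ⟨invG u, hu.inv, (gaugeAct_invG_gaugeAct u V).symm⟩
  · rintro ⟨u, hu, rfl⟩
    exact ⟨invG u, hu.inv, (gaugeAct_invG_gaugeAct u W).symm⟩

/-- Orbits are classes: a configuration on the orbit of `V` has the same orbit. [cite: Balaban1989LargeFieldI, (1.77) p.194] -/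
theorem orbit_eq_of_mem {S : Set (Site P k)} {V W : GaugeField P k G} (h : W ∈ orbit S V) : orbit S W = orbit S V := by
  obtain ⟨u, hu, rfl⟩ := h
  ext X
  constructor
  · rintro ⟨v, hv, rfl⟩
    exact ⟨mulG v u, hv.mul hu, gaugeAct_gaugeAct v u V⟩
  · rintro ⟨v, hv, rfl⟩
    refine ⟨mulG v (invG u), hv.mul hu.inv, ?_⟩
    rw [← gaugeAct_gaugeAct, gaugeAct_invG_gaugeAct]

/-- Two orbits coincide iff one configuration lies on the other's orbit. [cite: Balaban1989LargeFieldI, (1.77) p.194] -/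
theorem orbit_eq_orbit_iff {S : Set (Site P k)} {V W : GaugeField P k G} : orbit S W = orbit S V ↔ W ∈ orbit S V :=
  ⟨fun h => h ▸ mem_orbit_self S W, orbit_eq_of_mem⟩

variable (G) in
/-- THE ORBIT SPACE of the gauge transformations defined on `S` acting on the configurations of `T^{(k)}` — the range of
*"orbit-valued"* functions (p. 194: *"The orbit-valued function V_Λ(V_k↾_{Z∩Λᶜ})"*): the sets of the form `orbit S V`.
[cite: Balaban1989LargeFieldI, Prop. 1 p.194] -/
def OrbitSp (S : Set (Site P k)) : Type _ := {O : Set (GaugeField P k G) // ∃ V : GaugeField P k G, O = orbit S V}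

/-- The orbit of `V` as a point of the orbit space. [cite: Balaban1989LargeFieldI, Prop. 1 p.194] -/
def orbitOf (S : Set (Site P k)) (V : GaugeField P k G) : OrbitSp G S := ⟨orbit S V, V, rfl⟩

/-- The underlying set of `orbitOf S V` is `orbit S V`. [cite: Balaban1989LargeFieldI, Prop. 1 p.194] -/
@[simp] theorem orbitOf_val (S : Set (Site P k)) (V : GaugeField P k G) : (orbitOf S V).1 = orbit S V := rfl

/-- `V` lies on `orbitOf S V`. [cite: Balaban1989LargeFieldI, Prop. 1 p.194] -/
theorem mem_orbitOf_self (S : Set (Site P k)) (V : GaugeField P k G) : V ∈ (orbitOf S V).1 := mem_orbit_self S V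

/-- Every point of the orbit space is the orbit of some configuration. [cite: Balaban1989LargeFieldI, Prop. 1 p.194] -/
theorem OrbitSp.exists_eq_orbitOf {S : Set (Site P k)} (O : OrbitSp G S) : ∃ V : GaugeField P k G, O = orbitOf S V := by
  obtain ⟨V, hV⟩ := O.2
  exact ⟨V, Subtype.ext hV⟩

/-- Orbits are nonempty. [cite: Balaban1989LargeFieldI, Prop. 1 p.194] -/
theorem OrbitSp.nonempty {S : Set (Site P k)} (O : OrbitSp G S) : O.1.Nonempty := by
  obtain ⟨V, rfl⟩ := O.exists_eq_orbitOf
  exact ⟨V, mem_orbit_self S V⟩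

/-- An element determines its orbit: `orbitOf S V = O` for `V ∈ O`. [cite: Balaban1989LargeFieldI, Prop. 1 p.194] -/
theorem OrbitSp.orbitOf_eq_of_mem {S : Set (Site P k)} {O : OrbitSp G S} {V : GaugeField P k G} (hV : V ∈ O.1) :
    orbitOf S V = O := by
  obtain ⟨W, rfl⟩ := O.exists_eq_orbitOf
  exact Subtype.ext (orbit_eq_of_mem hV)

/-- Two points of the orbit space sharing an element are equal. [cite: Balaban1989LargeFieldI, Prop. 1 p.194] -/
theorem OrbitSp.eq_of_mem_of_mem {S : Set (Site P k)} {O O' : OrbitSp G S} {V : GaugeField P k G} (hV : V ∈ O.1)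
    (hV' : V ∈ O'.1) : O = O' :=
  (OrbitSp.orbitOf_eq_of_mem hV).symm.trans (OrbitSp.orbitOf_eq_of_mem hV')

/-- `orbitOf S V = orbitOf S W` iff `W` lies on the orbit of `V`. [cite: Balaban1989LargeFieldI, Prop. 1 p.194] -/
theorem orbitOf_eq_orbitOf_iff {S : Set (Site P k)} {V W : GaugeField P k G} : orbitOf S W = orbitOf S V ↔ W ∈ orbit S V := by
  rw [← orbit_eq_orbit_iff]
  exact ⟨fun h => congrArg Subtype.val h, fun h => Subtype.ext h⟩

end Orbits

/-! ## §3 The variables of (1.77): configurations with the boundary datum `V_k↾_{Z∩Λᶜ}` frozen -/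

section Variables

variable {G : Type*} {k : ℕ}

/-- The VARIABLES of the function (1.77) *"V_k↾_Λ → A(U_{k,Z}(V_k))"* at a frozen boundary datum: the configurations of `T^{(k)}`
equal to `V_k` off the bond set `Λb` (print: `Λb` = the bonds meeting `Λ^{(k)}`, p. 195 *"bonds intersecting ∂Λ belong to 𝔹₀"*;
p. 195 *"Extend the function V_Λ on the whole domain Z putting V_Λ = V_k on Z ∩ Λᶜ"*).  r11's `B15Sect1Instances.Ext175 Λ k V_k` is
the subtype of `extSet (bondsOf (pts k Λ)) V_k`. [cite: Balaban1989LargeFieldI, (1.77) p.194] -/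
def extSet (Λb : Set (PBond P k)) (Vk : GaugeField P k G) : Set (GaugeField P k G) := {W | ∀ b, b ∉ Λb → W b = Vk b}

/-- Membership in `extSet`, unfolded. [cite: Balaban1989LargeFieldI, (1.77) p.194] -/
theorem mem_extSet_iff {Λb : Set (PBond P k)} {Vk W : GaugeField P k G} : W ∈ extSet Λb Vk ↔ ∀ b, b ∉ Λb → W b = Vk b :=
  Iff.rfl

/-- The datum itself is one of the variables' values. [cite: Balaban1989LargeFieldI, (1.77) p.194] -/
theorem mem_extSet_self (Λb : Set (PBond P k)) (Vk : GaugeField P k G) : Vk ∈ extSet Λb Vk := fun _ _ => rfl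

/-- The variables depend on the datum only off `Λb` (*"For a configuration V_k↾_{Z∩Λᶜ}"*): two data agreeing off `Λb` have the same
variables. [cite: Balaban1989LargeFieldI, Prop. 1 p.194] -/
theorem extSet_eq_of_mem {Λb : Set (PBond P k)} {Vk W : GaugeField P k G} (h : W ∈ extSet Λb Vk) : extSet Λb W = extSet Λb Vk := by
  ext X
  exact ⟨fun hX b hb => (hX b hb).trans (h b hb), fun hX b hb => (hX b hb).trans (h b hb).symm⟩

/-- r11's extension type `Ext175 Λ k V_k` (p. 193 *"this field has an extension on the whole domain Z"*) consists of elements of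
`extSet (bondsOf (pts k Λ)) V_k`. [cite: Balaban1989LargeFieldI, (1.75) p.193] -/
theorem ext175_val_mem {Λ : Set (Site P 0)} {Vk : GaugeField P k G} (W : Ext175 Λ k Vk) : W.1 ∈ extSet (bondsOf (pts k Λ)) Vk := W.2

variable [GaugeGroup G]

/-- A gauge transformation defined on `Λ^{(k)}` maps the variables to themselves (it moves the bond variables on the bonds meeting
`Λ^{(k)}` only — r11's `gaugeAct_eq_of_not_mem`). [cite: Balaban1989LargeFieldI, (1.77) p.194] -/
theorem gaugeAct_mem_extSet {Λ : Set (Site P 0)} {u : GaugeTransf P k G} (hu : IsGaugeOn (pts k Λ) u) {Vk W : GaugeField P k G}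
    (hW : W ∈ extSet (bondsOf (pts k Λ)) Vk) : gaugeAct u W ∈ extSet (bondsOf (pts k Λ)) Vk :=
  fun b hb => (gaugeAct_eq_of_not_mem hu W hb).trans (hW b hb)

/-- The Λ-orbit through a value of the variables stays among the variables (the function (1.77) *"on orbits of this group"*).
[cite: Balaban1989LargeFieldI, (1.77) p.194] -/
theorem orbit_subset_extSet {Λ : Set (Site P 0)} {Vk W : GaugeField P k G} (hW : W ∈ extSet (bondsOf (pts k Λ)) Vk) :
    orbit (pts k Λ) W ⊆ extSet (bondsOf (pts k Λ)) Vk := by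
  rintro X ⟨u, hu, rfl⟩
  exact gaugeAct_mem_extSet hu hW

end Variables

/-! ## §4 Plaquettes *"p′ ⊂ X"* and the hypothesis *"|∂V_k − 1| < ε on the domain Z ∩ Λᶜ"* -/

section Plaquettes

variable {k : ℕ}

/-- The plaquettes `p′ ⊂ X` — ALL FOUR corners `x, x+e_μ, x+e_ν, x+e_μ+e_ν` in the site set `X` (p. 193, verbatim: *"satisfying the
regularity condition |V_k(∂p′) − 1| < ε for p′ ⊂ Z ∩ Λᶜ"*); compare the corner-MEETING convention `B8Eq17ClassAkV1.plaqsOf`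
([14] p. 77, [I] p. 251) used for *"p′ ∈ Λ"* in (1.78). [cite: Balaban1989LargeFieldI, (1.75) p.193] -/
def plaqsInside (X : Set (Site P k)) : Set (Plaq P k) :=
  {p | p.src ∈ X ∧ p.src.shift p.μ ∈ X ∧ p.src.shift p.ν ∈ X ∧ (p.src.shift p.μ).shift p.ν ∈ X}

/-- Membership in `plaqsInside`, unfolded. [cite: Balaban1989LargeFieldI, (1.75) p.193] -/
theorem mem_plaqsInside_iff {X : Set (Site P k)} {p : Plaq P k} :
    p ∈ plaqsInside X ↔ p.src ∈ X ∧ p.src.shift p.μ ∈ X ∧ p.src.shift p.ν ∈ X ∧ (p.src.shift p.μ).shift p.ν ∈ X := Iff.rfl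

/-- `p′ ⊂ X` implies `p′ ∈ X` (a corner in `X`). [cite: Balaban1989LargeFieldI, (1.75) p.193] -/
theorem plaqsInside_subset_plaqsOf (X : Set (Site P k)) : plaqsInside X ⊆ plaqsOf X := fun _ hp => Or.inl hp.1

/-- Monotonicity of `plaqsInside`. [cite: Balaban1989LargeFieldI, (1.75) p.193] -/
theorem plaqsInside_mono {X Y : Set (Site P k)} (h : X ⊆ Y) : plaqsInside X ⊆ plaqsInside Y :=
  fun _ hp => ⟨h hp.1, h hp.2.1, h hp.2.2.1, h hp.2.2.2⟩

/-- `p′ ⊂ Xᶜ` iff `p′ ∉ X` in the corner-meeting convention: the two plaquette classes are complementary.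
[cite: Balaban1989LargeFieldI, (1.75) p.193] -/
theorem mem_plaqsInside_compl_iff {X : Set (Site P k)} {p : Plaq P k} : p ∈ plaqsInside Xᶜ ↔ p ∉ plaqsOf X := by
  simp only [mem_plaqsInside_iff, mem_compl_iff, mem_plaqsOf, not_or]

/-- `p′ ⊂ X ∩ Y` iff `p′ ⊂ X` and `p′ ⊂ Y`. [cite: Balaban1989LargeFieldI, (1.75) p.193] -/
theorem mem_plaqsInside_inter_iff {X Y : Set (Site P k)} {p : Plaq P k} :
    p ∈ plaqsInside (X ∩ Y) ↔ p ∈ plaqsInside X ∧ p ∈ plaqsInside Y := by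
  simp only [mem_plaqsInside_iff, mem_inter_iff]
  tauto

/-- The `k`-lattice points of `Z ∩ Λᶜ` are those of `Z` off those of `Λ` (`pts` is a preimage). [cite: Balaban1987RG1, (0.1) p.251] -/
theorem pts_inter_compl (Z Λ : Set (Site P 0)) : pts k (Z ∩ Λᶜ) = pts k Z ∩ (pts k Λ)ᶜ := rfl

/-- Unit shifts in two directions commute on the torus. [folklore] -/
private theorem shift_comm (x : Site P k) (μ ν : Fin P.d) : (x.shift μ).shift ν = (x.shift ν).shift μ := by
  funext κ
  by_cases hκν : κ = ν
  · subst hκν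
    by_cases hκμ : κ = μ
    · subst hκμ; rfl
    · simp [Site.shift, Function.update_apply, hκμ]
  · by_cases hκμ : κ = μ
    · subst hκμ
      simp [Site.shift, Function.update_apply, hκν]
    · simp [Site.shift, Function.update_apply, hκμ, hκν]

/-- The four bonds of a plaquette `p′ ⊂ Sᶜ` do not meet `S` (both endpoints of each are corners of `p′`).
[cite: Balaban1989LargeFieldI, (1.75) p.193] -/
theorem not_mem_bondsOf_of_mem_plaqBonds {S : Set (Site P k)} {p : Plaq P k} (hp : p ∈ plaqsInside Sᶜ) {b : PBond P k}
    (hb : b ∈ plaqBonds p) : b ∉ bondsOf S := by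
  obtain ⟨h1, h2, h3, h4⟩ := hp
  have h4' : (p.src.shift p.ν).shift p.μ ∉ S := by rw [← shift_comm]; exact h4
  rcases mem_plaqBonds.1 hb with rfl | rfl | rfl | rfl
  · rintro (h | h) <;> simp_all [PBond.tgt]
  · rintro (h | h) <;> simp_all [PBond.tgt]
  · rintro (h | h) <;> simp_all [PBond.tgt]
  · rintro (h | h) <;> simp_all [PBond.tgt]

variable {G : Type*} [GaugeGroup G]

/-- The plaquette variable of a plaquette `p′ ⊂ (Λ^{(k)})ᶜ` does not see the variables `V_k↾_Λ`: two configurations agreeing off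
the bonds meeting `Λ^{(k)}` have the same `V(∂p′)` (`B14.Eq12InteriorLocality.plaqHol_congr`). [cite: Balaban1989LargeFieldI, (1.75) p.193] -/
theorem plaqHol_eq_of_eqOff {S : Set (Site P k)} {W W' : GaugeField P k G} (h : ∀ b, b ∉ bondsOf S → W b = W' b)
    {p : Plaq P k} (hp : p ∈ plaqsInside Sᶜ) : plaqHol W p = plaqHol W' p :=
  plaqHol_congr fun b hb => h b (not_mem_bondsOf_of_mem_plaqBonds hp hb)

/-- THE HYPOTHESIS OF PROPOSITION 1 depends on `V_k↾_{Z∩Λᶜ}` only: *"For a configuration V_k↾_{Z∩Λᶜ}, satisfying the regularity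
condition |∂V_k − 1| < ε on the domain Z ∩ Λᶜ"* read as `Setup.PlaqSmallOn (plaqsInside (Z ∩ Λᶜ)^{(k)}) ε` is the same for two
configurations agreeing off the bonds meeting `Λ^{(k)}`. [cite: Balaban1989LargeFieldI, Prop. 1 p.194] -/
theorem plaqSmallOn_inside_congr {Z Λ : Set (Site P 0)} {ε : ℝ} {W W' : GaugeField P k G}
    (h : ∀ b, b ∉ bondsOf (pts k Λ) → W b = W' b) :
    PlaqSmallOn (plaqsInside (pts k (Z ∩ Λᶜ))) ε W ↔ PlaqSmallOn (plaqsInside (pts k (Z ∩ Λᶜ))) ε W' := by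
  have key : ∀ p ∈ plaqsInside (pts k (Z ∩ Λᶜ)), plaqHol W p = plaqHol W' p := fun p hp =>
    plaqHol_eq_of_eqOff h ((mem_plaqsInside_inter_iff.1 (by rwa [pts_inter_compl] at hp)).2)
  constructor
  · intro hW p hp
    rw [← key p hp]; exact hW p hp
  · intro hW p hp
    rw [key p hp]; exact hW p hp

end Plaquettes

/-! ## §5 The deviation of (1.78) on an orbit -/

section Deviation

variable {G : Type*} [GaugeGroup G] {k : ℕ}

/-- `|V^u(∂p) − 1| = |V(∂p) − 1|`: the plaquette deviation is constant along gauge orbits (`U^u(∂p) = u(x)U(∂p)u(x)⁻¹`,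
`T4ReTrLipUnitary.plaqHol_gaugeAct`, and `GaugeGroup.dist1_conj`) — so (1.78) is a statement about the ORBIT.
[cite: Balaban1989LargeFieldI, (1.78) p.194] -/
theorem dist1_plaqHol_gaugeAct (u : GaugeTransf P k G) (V : GaugeField P k G) (p : Plaq P k) :
    dist1 (plaqHol (gaugeAct u V) p) = dist1 (plaqHol V p) := by
  rw [T4ReTrLipUnitary.plaqHol_gaugeAct]
  exact GaugeGroup.dist1_conj _ _

/-- The index set of the deviation of an orbit `O` over a plaquette set `Λp`: pairs `(V, p′)` with `V ∈ O`, `p′ ∈ Λp`.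
[cite: Balaban1989LargeFieldI, (1.78) p.194] -/
abbrev DevIdx (Λp : Set (Plaq P k)) (O : Set (GaugeField P k G)) : Type _ :=
  {x : GaugeField P k G × Plaq P k // x.1 ∈ O ∧ x.2 ∈ Λp}

/-- **The deviation of (1.78) on an orbit**: `sup {|V(∂p′) − 1| : V ∈ O, p′ ∈ Λp}` (print: *"An element of the orbit … denoted by
V_Λ … satisfies the regularity condition |V_Λ(∂p′) − 1| < B₅M⁵ε for p′ ∈ Λ"*; by `dist1_plaqHol_gaugeAct` every element of the
orbit has the same plaquette deviations).  Junk value `0` on an empty index set (Mathlib's `sSup ∅ = 0` on `ℝ`).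
[cite: Balaban1989LargeFieldI, (1.78) p.194] -/
def orbitDev (Λp : Set (Plaq P k)) (O : Set (GaugeField P k G)) : ℝ :=
  ⨆ x : DevIdx Λp O, dist1 (plaqHol x.1.1 x.1.2)

/-- On an orbit the deviations range inside the finitely many deviations of ONE element. [cite: Balaban1989LargeFieldI, (1.78) p.194] -/
theorem range_dev_subset {S : Set (Site P k)} {Λp : Set (Plaq P k)} {O : Set (GaugeField P k G)} {V₀ : GaugeField P k G}
    (hO : O = orbit S V₀) :
    Set.range (fun x : DevIdx Λp O => dist1 (plaqHol x.1.1 x.1.2)) ⊆ Set.range fun p : Plaq P k => dist1 (plaqHol V₀ p) := by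
  subst hO
  rintro r ⟨x, rfl⟩
  obtain ⟨⟨V, p⟩, hV, hp⟩ := x
  obtain ⟨u, hu, hVu⟩ := hV
  refine ⟨p, ?_⟩
  dsimp only at hVu ⊢
  rw [hVu, dist1_plaqHol_gaugeAct]

/-- The deviations of an orbit form a finite, hence bounded, set. [cite: Balaban1989LargeFieldI, (1.78) p.194] -/
theorem bddAbove_range_dev {S : Set (Site P k)} {Λp : Set (Plaq P k)} {O : Set (GaugeField P k G)} (hO : ∃ V₀, O = orbit S V₀) :
    BddAbove (Set.range fun x : DevIdx Λp O => dist1 (plaqHol x.1.1 x.1.2)) := by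
  obtain ⟨V₀, hV₀⟩ := hO
  exact ((Set.finite_range _).subset (range_dev_subset hV₀)).bddAbove

/-- Every element of the orbit and every `p′ ∈ Λp` is dominated by the orbit deviation. [cite: Balaban1989LargeFieldI, (1.78) p.194] -/
theorem le_orbitDev {S : Set (Site P k)} {Λp : Set (Plaq P k)} {O : Set (GaugeField P k G)} (hO : ∃ V₀, O = orbit S V₀)
    {V : GaugeField P k G} (hV : V ∈ O) {p : Plaq P k} (hp : p ∈ Λp) : dist1 (plaqHol V p) ≤ orbitDev Λp O :=
  le_ciSup (bddAbove_range_dev hO) (⟨(V, p), hV, hp⟩ : DevIdx Λp O)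

/-- (1.78) for the orbit ⇒ (1.78) for each of its elements and each `p′`. [cite: Balaban1989LargeFieldI, (1.78) p.194] -/
theorem dist1_lt_of_orbitDev_lt {S : Set (Site P k)} {Λp : Set (Plaq P k)} {O : Set (GaugeField P k G)}
    (hO : ∃ V₀, O = orbit S V₀) {c : ℝ} (hc : orbitDev Λp O < c) {V : GaugeField P k G} (hV : V ∈ O) {p : Plaq P k}
    (hp : p ∈ Λp) : dist1 (plaqHol V p) < c :=
  (le_orbitDev hO hV hp).trans_lt hc

/-- (1.78) for every element and every `p′` ⇒ (1.78) for the orbit (finite range; `0 < c` covers the empty plaquette set).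
[cite: Balaban1989LargeFieldI, (1.78) p.194] -/
theorem orbitDev_lt_of_forall {S : Set (Site P k)} {Λp : Set (Plaq P k)} {O : Set (GaugeField P k G)}
    (hO : ∃ V₀, O = orbit S V₀) {c : ℝ} (hc : 0 < c) (h : ∀ V ∈ O, ∀ p ∈ Λp, dist1 (plaqHol V p) < c) :
    orbitDev Λp O < c := by
  obtain ⟨V₀, hV₀⟩ := hO
  have hfin : (Set.range fun x : DevIdx Λp O => dist1 (plaqHol x.1.1 x.1.2)).Finite :=
    (Set.finite_range _).subset (range_dev_subset hV₀)
  unfold orbitDev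
  by_cases hne : (Set.range fun x : DevIdx Λp O => dist1 (plaqHol x.1.1 x.1.2)).Nonempty
  · obtain ⟨⟨⟨V, p⟩, hV, hp⟩, hx⟩ := Set.Nonempty.csSup_mem hne hfin
    rw [iSup, ← hx]
    exact h V hV p hp
  · rw [Set.not_nonempty_iff_eq_empty] at hne
    rw [iSup, hne, Real.sSup_empty]
    exact hc

/-- For a single configuration's deviation, by gauge invariance: on the orbit of `V₀` the orbit deviation is below `c > 0` as soon as
`|V₀(∂p′) − 1| < c` for `p′ ∈ Λp`. [cite: Balaban1989LargeFieldI, (1.78) p.194] -/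
theorem orbitDev_orbit_lt {S : Set (Site P k)} {Λp : Set (Plaq P k)} {V₀ : GaugeField P k G} {c : ℝ} (hc : 0 < c)
    (h : ∀ p ∈ Λp, dist1 (plaqHol V₀ p) < c) : orbitDev Λp (orbit S V₀) < c := by
  refine orbitDev_lt_of_forall ⟨V₀, rfl⟩ hc fun V hV p hp => ?_
  obtain ⟨u, -, rfl⟩ := hV
  rw [dist1_plaqHol_gaugeAct]
  exact h p hp

end Deviation

/-! ## §6 Critical configurations through the exponential chart ([LF-II] p. 359) -/

section Critical

variable {G : Type*} [GaugeGroup G] {𝔤 : Type*} [AddCommGroup 𝔤] [Module ℝ 𝔤] (ch : ExpChart G 𝔤) {k : ℕ}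

/-- A `𝔤`-valued bond field SUPPORTED on the bond set `Λb` (the directions `δB′` of (1.12) live on the bonds of `Λ`).
[cite: Balaban1989LargeFieldII, (1.12) p.359] -/
def IsSupportedOn (Λb : Set (PBond P k)) (A : VecField P k 𝔤) : Prop := ∀ b, b ∉ Λb → A b = 0

/-- **CRITICAL CONFIGURATION** of a function `f` of the variables `V_k↾_Λ` ([LF-II] p. 359, verbatim: *"Fixing the gauge G₀ for V′ we
get a small configuration, and we can write V′ = exp iB′. We expand the function with respect to B′ … Now the condition for a
critical configuration is the equation (1.12)"*; [IV] p. 194 *"critical orbit of the function (1.77)"*): through the exponential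
chart `ch` (`exp i(·)`, DATA — READING), every one-parameter variation `s ↦ f((exp isA)·V)` in a direction `A` supported on `Λb`
has derivative `0` at `s = 0`. [cite: Balaban1989LargeFieldI, Prop. 1 p.194; Balaban1989LargeFieldII, (1.12) p.359] -/
def IsCriticalPt (Λb : Set (PBond P k)) (f : GaugeField P k G → ℝ) (V : GaugeField P k G) : Prop :=
  ∀ A : VecField P k 𝔤, IsSupportedOn Λb A → HasDerivAt (fun s : ℝ => f (expMul ch (s • A) V)) 0 0

/-- The variation passes through `V` at `s = 0` (`exp i0 = 1`). [cite: Balaban1989LargeFieldII, (1.19) p.360] -/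
theorem expMul_zero_smul (A : VecField P k 𝔤) (V : GaugeField P k G) : expMul ch ((0 : ℝ) • A) V = V := by
  rw [zero_smul]; exact expMul_zero ch V

/-- A variation in a direction supported on `Λb` stays among the variables of (1.77) (it moves the bond variables on `Λb` only).
[cite: Balaban1989LargeFieldI, (1.77) p.194] -/
theorem expMul_smul_mem_extSet {Λb : Set (PBond P k)} {A : VecField P k 𝔤} (hA : IsSupportedOn Λb A) {Vk V : GaugeField P k G}
    (hV : V ∈ extSet Λb Vk) (s : ℝ) : expMul ch (s • A) V ∈ extSet Λb Vk := by
  intro b hb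
  have : (s • A) b = 0 := by simp [hA b hb]
  simp [expMul, this, ch.iexp_zero, hV b hb]

/-- **Criticality passes along Λ-orbits of an invariant function when the chart is Ad-covariant** (HONEST SCOPE (ii)): given a map
`ad : G → 𝔤 →ₗ[ℝ] 𝔤` with `exp i(ad(g)X) = g (exp iX) g⁻¹` (DISPLAYED hypothesis — the matrix exponential has it; the abstract
`ExpChart` is not assumed to), if `f` is invariant under the gauge transformations defined on `S` and `V` is critical, so is `V^u`
for every `u` defined on `S`: the variation of `V^u` in the direction `A` is the `u`-transform of the variation of `V` in the
direction `ad(u(b₋)⁻¹)A(b)`. [cite: Balaban1989LargeFieldI, (1.77) p.194; Balaban1989LargeFieldII, (1.12) p.359] -/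
theorem IsCriticalPt.gaugeAct_of_adCov (ad : G → 𝔤 →ₗ[ℝ] 𝔤) (had : ∀ (g : G) (X : 𝔤), ch.iexp (ad g X) = g * ch.iexp X * g⁻¹)
    {S : Set (Site P k)} {Λb : Set (PBond P k)} {f : GaugeField P k G → ℝ}
    (hf : ∀ u : GaugeTransf P k G, IsGaugeOn S u → ∀ V, f (gaugeAct u V) = f V) {u : GaugeTransf P k G} (hu : IsGaugeOn S u)
    {V : GaugeField P k G} (hV : IsCriticalPt ch Λb f V) : IsCriticalPt ch Λb f (GaugeField.gaugeAct u V) := by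
  intro A hA
  -- the transported direction
  set A' : VecField P k 𝔤 := fun b => ad (u b.src)⁻¹ (A b) with hA'
  have hA's : IsSupportedOn Λb A' := fun b hb => by simp [hA', hA b hb]
  have key : ∀ s : ℝ, expMul ch (s • A) (gaugeAct u V) = gaugeAct u (expMul ch (s • A') V) := by
    intro s
    funext b
    have h1 : (s • A') b = ad (u b.src)⁻¹ ((s • A) b) := by simp [hA', map_smul]
    simp only [expMul, gaugeAct, h1, had]
    group
  have hcurve : (fun s : ℝ => f (expMul ch (s • A) (gaugeAct u V))) = fun s : ℝ => f (expMul ch (s • A') V) := by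
    funext s; rw [key s, hf u hu]
  rw [hcurve]
  exact hV A' hA's

end Critical

/-! ## §7 *"A minimum of the function"* over the variables -/

section Minimum

variable {G : Type*} {k : ℕ}

/-- **MINIMUM of a function of the variables `V_k↾_Λ`** (p. 194 *"We look for a minimal orbit … An element of the orbit is a minimum
of the function"*): `V` is a value of the variables (equal to `V_k` off `Λb`) and `f V ≤ f W` for every value `W` of the variables —
r12's `B15DeterminingSets.IsVLambda` for a general `f` (`isVLambda_iff_isMinPt`). [cite: Balaban1989LargeFieldI, Prop. 1 p.194] -/
def IsMinPt (Λb : Set (PBond P k)) (f : GaugeField P k G → ℝ) (Vk V : GaugeField P k G) : Prop :=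
  V ∈ extSet Λb Vk ∧ ∀ W ∈ extSet Λb Vk, f V ≤ f W

/-- A minimum depends on the datum only off `Λb`. [cite: Balaban1989LargeFieldI, Prop. 1 p.194] -/
theorem IsMinPt.of_eqOff {Λb : Set (PBond P k)} {f : GaugeField P k G → ℝ} {Vk Vk' V : GaugeField P k G}
    (h : IsMinPt Λb f Vk V) (hVk : Vk' ∈ extSet Λb Vk) : IsMinPt Λb f Vk' V := by
  rw [IsMinPt, extSet_eq_of_mem hVk]
  exact h

variable [GaugeGroup G]

/-- r12's minimiser predicate `IsVLambda bg 𝔹 Qs Λb V_out V_Λ` of (1.77) IS `IsMinPt Λb (fun177 bg 𝔹 Qs) V_out V_Λ` (definitional).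
[cite: Balaban1989LargeFieldI, Prop. 1 (1.78) p.194] -/
theorem isVLambda_iff_isMinPt {av : ∀ j, Averaging P j G} (bg : DetBackground P G av) (BkZ : DetSet P)
    (Qs : GaugeField P k G → GaugeField P 0 G) (Λb : Set (PBond P k)) (Vout VΛ : GaugeField P k G) :
    IsVLambda bg BkZ Qs Λb Vout VΛ ↔ IsMinPt Λb (fun177 bg BkZ Qs) Vout VΛ := Iff.rfl

/-- **Minimality passes along Λ-orbits of an invariant function** (p. 194 *"We look for a minimal orbit"*): for `f` invariant under
the gauge transformations defined on `Λ^{(k)}` and `u` such a transformation, `V^u` is a minimum with `V`.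
[cite: Balaban1989LargeFieldI, Prop. 1 p.194] -/
theorem IsMinPt.gaugeAct {Λ : Set (Site P 0)} {f : GaugeField P k G → ℝ}
    (hf : ∀ u : GaugeTransf P k G, IsGaugeOn (pts k Λ) u → ∀ V, f (gaugeAct u V) = f V) {u : GaugeTransf P k G}
    (hu : IsGaugeOn (pts k Λ) u) {Vk V : GaugeField P k G} (h : IsMinPt (bondsOf (pts k Λ)) f Vk V) :
    IsMinPt (bondsOf (pts k Λ)) f Vk (GaugeField.gaugeAct u V) :=
  ⟨gaugeAct_mem_extSet hu h.1, fun W hW => by rw [hf u hu V]; exact h.2 W hW⟩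

/-- On a Λ-orbit of an invariant `f`: SOME element is a minimum iff EVERY element is. [cite: Balaban1989LargeFieldI, Prop. 1 p.194] -/
theorem exists_isMinPt_iff_forall {Λ : Set (Site P 0)} {f : GaugeField P k G → ℝ}
    (hf : ∀ u : GaugeTransf P k G, IsGaugeOn (pts k Λ) u → ∀ V, f (gaugeAct u V) = f V) {Vk : GaugeField P k G}
    (O : OrbitSp G (pts k Λ)) :
    (∃ V ∈ O.1, IsMinPt (bondsOf (pts k Λ)) f Vk V) ↔ ∀ V ∈ O.1, IsMinPt (bondsOf (pts k Λ)) f Vk V := by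
  refine ⟨fun ⟨V, hV, hmin⟩ W hW => ?_, fun h => ?_⟩
  · have hWV : W ∈ orbit (pts k Λ) V := by
      rw [← orbitOf_val, OrbitSp.orbitOf_eq_of_mem hV]; exact hW
    obtain ⟨u, hu, rfl⟩ := hWV
    exact hmin.gaugeAct hf hu
  · obtain ⟨V, hV⟩ := O.nonempty
    exact ⟨V, hV, h V hV⟩

variable {𝔤 : Type*} [AddCommGroup 𝔤] [Module ℝ 𝔤] (ch : ExpChart G 𝔤)

/-- **A minimum is critical** whenever its variations through the chart are differentiable at `s = 0` (Fermat; the variations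
stay among the variables, `expMul_smul_mem_extSet`) — [IV] p. 194 *"An element of the orbit is a minimum of the function"* and
[LF-II] p. 359 *"the condition for a critical configuration"* are consistent.  Differentiability is a HYPOTHESIS (HONEST SCOPE (iii)).
[cite: Balaban1989LargeFieldI, Prop. 1 p.194; Balaban1989LargeFieldII, (1.12) p.359] -/
theorem IsMinPt.isCriticalPt {Λb : Set (PBond P k)} {f : GaugeField P k G → ℝ} {Vk V : GaugeField P k G}
    (h : IsMinPt Λb f Vk V)
    (hd : ∀ A : VecField P k 𝔤, IsSupportedOn Λb A → DifferentiableAt ℝ (fun s : ℝ => f (expMul ch (s • A) V)) 0) :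
    IsCriticalPt ch Λb f V := by
  intro A hA
  have hmin : IsLocalMin (fun s : ℝ => f (expMul ch (s • A) V)) 0 := by
    refine Filter.Eventually.of_forall fun s => ?_
    show f (expMul ch ((0 : ℝ) • A) V) ≤ f (expMul ch (s • A) V)
    rw [expMul_zero_smul]
    exact h.2 _ (expMul_smul_mem_extSet ch hA h.1 s)
  have hderiv := (hd A hA).hasDerivAt
  rwa [hmin.deriv_eq_zero] at hderiv

end Minimum

/-! ## §8 THE CARRIER OF PRINT `lfVar : B15.LFVar` and Proposition 1 unfolded at it -/

section Carrier

/-- **AN INSTANCE OF PROPOSITION 1** (the data one application reads; p. 194 and p. 195 *"The constant B₅ is determined by the geometry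
of the problem"*): the step `k`; the large-field region `Z ⊂ T_η` and the domain `Λ ⊂ Z` (subsets of the finest lattice, r12's
READING (a) of `B15DeterminingSets`); the cube size `M` of the power `M⁵` in (1.78) ([LF-II] p. 358 *"Λ is … contained in a cube of
the size 100M"*); THE FUNCTION (1.77) `f` of the configurations `V_k` (print's instance: `Inst.std`, §9); and the analytic-extension
clause `An ε V_k` of Proposition 1 CARRIED AS DATA (HONEST SCOPE (i)). [cite: Balaban1989LargeFieldI, Prop. 1 (1.77)–(1.78) p.194] -/
structure Inst (P : Params) (G : Type) where
  /-- the step `k` of the procedure (the lattice `T^{(k)}` of the variables `V_k`) -/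
  k : ℕ
  /-- the large-field region `Z ⊂ T_η` -/
  Z : Set (Site P 0)
  /-- the domain `Λ` of the variables `V_k↾_Λ` -/
  Λ : Set (Site P 0)
  /-- the cube size `M` (the power `M⁵` of (1.78)) -/
  M : ℝ
  /-- the function (1.77) `V_k ↦ A(U_{k,Z}(V_k))` -/
  f : GaugeField P k G → ℝ
  /-- the analytic-extension clause of Proposition 1 at smallness `ε` and datum `V_k` (carried, not modelled) -/
  An : ℝ → GaugeField P k G → Prop

variable {G : Type} [GaugeGroup G] {𝔤 : Type*} [AddCommGroup 𝔤] [Module ℝ 𝔤]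

/-- **THE CARRIER OF PROPOSITION 1 — THE `dom = ⊤` READING** (v1; the carrier OF RECORD, with the DOMAIN of (1.77), is `lfVarOn` of
§11: on the uniqueness clause *"exactly one critical orbit"* THIS reading ranges over EVERY Λ-orbit of the variables and is there
STRONGER than print — v1.1 header paragraph; kernel form: dag-n12-c's `B15Prop1CarrierDomain.not_prop1Printed_lfVar_of_compact`)
for a family of instances `I : ι → Inst P G` and a chart `ch`: instances `ι`, letter
`M`; boundary data = configurations `V_k` of `T^{(k)}` (read off `Λ`: *"For a configuration V_k↾_{Z∩Λᶜ}"*, `plaqSmallOn_inside_congr`,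
`extSet_eq_of_mem`); ORBITS = the orbit space of the gauge transformations defined on `Λ^{(k)}`; `Regular i ε V_k` = *"|∂V_k − 1| < ε
on the domain Z ∩ Λᶜ"* (`PlaqSmallOn` on the plaquettes `p′ ⊂ (Z ∩ Λᶜ)^{(k)}`); `IsCritical i V_k O` = `O` lies in the variables at
the datum `V_k` and contains a critical configuration of (1.77); `IsMinimum i V_k O` = *"An element of the orbit is a minimum of the
function"*; `dev i O` = `sup_{V∈O, p′∈Λ} |V(∂p′) − 1|` (`p′ ∈ Λ` by `plaqsOf`); `AnalyticExt` = the carried clause.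
[cite: Balaban1989LargeFieldI, Prop. 1 (1.77)–(1.78) p.194] -/
def lfVar (ch : ExpChart G 𝔤) {ι : Type} (I : ι → Inst P G) : B15.LFVar where
  Inst := ι
  M i := (I i).M
  Bdry i := GaugeField P (I i).k G
  Orbit i := OrbitSp G (pts (I i).k (I i).Λ)
  Regular i ε Vk := PlaqSmallOn (plaqsInside (pts (I i).k ((I i).Z ∩ ((I i).Λ)ᶜ))) ε Vk
  IsCritical i Vk O :=
    O.1 ⊆ extSet (bondsOf (pts (I i).k (I i).Λ)) Vk ∧ ∃ V ∈ O.1, IsCriticalPt ch (bondsOf (pts (I i).k (I i).Λ)) (I i).f V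
  IsMinimum i Vk O := ∃ V ∈ O.1, IsMinPt (bondsOf (pts (I i).k (I i).Λ)) (I i).f Vk V
  dev i O := orbitDev (plaqsOf (pts (I i).k (I i).Λ)) O.1
  AnalyticExt i ε Vk := (I i).An ε Vk

/-- **PROPOSITION 1 [IV] AT THE LATTICE CARRIER, `dom = ⊤` READING** (of record: `prop1Printed_lfVarOn_iff`, §11) — the statement of
record `B15.Prop1Printed (lfVar ch I)` UNFOLDED
(definitional): *there is `B₅ > 0` such that for every instance `i` there is a threshold `e0 > 0` such that for all `0 < ε ≤ e0` and
every configuration `V_k` with `|V_k(∂p′) − 1| < ε` for all `p′ ⊂ (Z ∩ Λᶜ)^{(k)}`, there is an orbit `O` of the gauge transformations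
defined on `Λ^{(k)}`, lying in the configurations equal to `V_k` off the bonds meeting `Λ^{(k)}` and containing a critical
configuration of the function (1.77), which is the ONLY such orbit, which contains a minimum of the function over those
configurations, whose deviation `sup_{V∈O, p′∈Λ} |V(∂p′) − 1|` is `< B₅M⁵ε`, and the analytic-extension clause holds at `(ε, V_k)`.*
NOT asserted — this is the sentence to be inhabited at NODE 00's objects. [cite: Balaban1989LargeFieldI, Prop. 1 (1.78) p.194] -/
theorem prop1Printed_lfVar_iff (ch : ExpChart G 𝔤) {ι : Type} (I : ι → Inst P G) :
    B15.Prop1Printed (lfVar ch I) ↔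
      ∃ B₅ : ℝ, 0 < B₅ ∧ ∀ i : ι, ∃ e0 : ℝ, 0 < e0 ∧ ∀ ε : ℝ, 0 < ε → ε ≤ e0 →
        ∀ Vk : GaugeField P (I i).k G, PlaqSmallOn (plaqsInside (pts (I i).k ((I i).Z ∩ ((I i).Λ)ᶜ))) ε Vk →
          ∃ O : OrbitSp G (pts (I i).k (I i).Λ),
            (O.1 ⊆ extSet (bondsOf (pts (I i).k (I i).Λ)) Vk ∧
                ∃ V ∈ O.1, IsCriticalPt ch (bondsOf (pts (I i).k (I i).Λ)) (I i).f V) ∧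
              (∀ O' : OrbitSp G (pts (I i).k (I i).Λ),
                (O'.1 ⊆ extSet (bondsOf (pts (I i).k (I i).Λ)) Vk ∧
                    ∃ V ∈ O'.1, IsCriticalPt ch (bondsOf (pts (I i).k (I i).Λ)) (I i).f V) → O' = O) ∧
              (∃ V ∈ O.1, IsMinPt (bondsOf (pts (I i).k (I i).Λ)) (I i).f Vk V) ∧
              orbitDev (plaqsOf (pts (I i).k (I i).Λ)) O.1 < B₅ * (I i).M ^ 5 * ε ∧ (I i).An ε Vk :=
  Iff.rfl

/-- **(1.78) FOR THE ELEMENT `V_Λ`** (print: *"An element of the orbit is a minimum of the function, and is denoted by V_Λ =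
V_Λ(V_k↾_{Z∩Λᶜ}). It satisfies the regularity condition |V_Λ(∂p′) − 1| < B₅M⁵ε for p′ ∈ Λ"*): from Proposition 1 at the lattice
carrier, every regular datum `V_k` below the threshold has a MINIMISER `V_Λ` of (1.77) over the configurations equal to `V_k` off
`Λ`, with `|V_Λ(∂p′) − 1| < B₅M⁵ε` for every plaquette `p′` meeting `Λ^{(k)}`. [cite: Balaban1989LargeFieldI, Prop. 1 (1.78) p.194] -/
theorem exists_minimizer_of_prop1Printed (ch : ExpChart G 𝔤) {ι : Type} {I : ι → Inst P G} (h : B15.Prop1Printed (lfVar ch I)) :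
    ∃ B₅ : ℝ, 0 < B₅ ∧ ∀ i : ι, ∃ e0 : ℝ, 0 < e0 ∧ ∀ ε : ℝ, 0 < ε → ε ≤ e0 →
      ∀ Vk : GaugeField P (I i).k G, PlaqSmallOn (plaqsInside (pts (I i).k ((I i).Z ∩ ((I i).Λ)ᶜ))) ε Vk →
        ∃ VΛ : GaugeField P (I i).k G, IsMinPt (bondsOf (pts (I i).k (I i).Λ)) (I i).f Vk VΛ ∧
          ∀ p ∈ plaqsOf (pts (I i).k (I i).Λ), dist1 (plaqHol VΛ p) < B₅ * (I i).M ^ 5 * ε := by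
  obtain ⟨B₅, hB₅, hall⟩ := (prop1Printed_lfVar_iff ch I).1 h
  refine ⟨B₅, hB₅, fun i => ?_⟩
  obtain ⟨e0, he0, hε⟩ := hall i
  refine ⟨e0, he0, fun ε hεpos hεle Vk hreg => ?_⟩
  obtain ⟨O, -, -, ⟨V, hV, hmin⟩, hdev, -⟩ := hε ε hεpos hεle Vk hreg
  exact ⟨V, hmin, fun p hp => dist1_lt_of_orbitDev_lt O.2 hdev hV hp⟩

/-- Conversely, the `dev` conjunct of Proposition 1 at the lattice carrier follows from (1.78) at ONE element of the orbit
(`0 < B₅M⁵ε`). [cite: Balaban1989LargeFieldI, Prop. 1 (1.78) p.194] -/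
theorem dev_lt_of_mem (ch : ExpChart G 𝔤) {ι : Type} (I : ι → Inst P G) (i : ι) (O : (lfVar ch I).Orbit i)
    {V : GaugeField P (I i).k G} (hV : V ∈ O.1) {c : ℝ} (hc : 0 < c)
    (h : ∀ p ∈ plaqsOf (pts (I i).k (I i).Λ), dist1 (plaqHol V p) < c) : (lfVar ch I).dev i O < c := by
  obtain ⟨V₀, hO⟩ := O.exists_eq_orbitOf
  subst hO
  show orbitDev (plaqsOf (pts (I i).k (I i).Λ)) (orbit (pts (I i).k (I i).Λ) V₀) < c
  have hV' : V ∈ orbit (pts (I i).k (I i).Λ) V₀ := hV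
  rw [← orbit_eq_of_mem hV']
  exact orbitDev_orbit_lt hc h

/-- The `Regular` hypothesis of the carrier reads the datum off `Λ` only. [cite: Balaban1989LargeFieldI, Prop. 1 p.194] -/
theorem regular_congr (ch : ExpChart G 𝔤) {ι : Type} (I : ι → Inst P G) (i : ι) {ε : ℝ} {Vk Vk' : GaugeField P (I i).k G}
    (hVk : ∀ b, b ∉ bondsOf (pts (I i).k (I i).Λ) → Vk b = Vk' b) :
    (lfVar ch I).Regular i ε Vk ↔ (lfVar ch I).Regular i ε Vk' :=
  plaqSmallOn_inside_congr hVk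

end Carrier

/-! ## §9 Print's instance: the function (1.77) `A(U_{k,Z}(V_k))` of r11's `B15Sect1Instances` -/

section Std

variable {G : Type} [GaugeGroup G] {𝔤 : Type*} [AddCommGroup 𝔤] [Module ℝ 𝔤] {av : ∀ j, Averaging P j G}
  (bg : DetBackground P G av) (M₁ : ℕ)

/-- **PRINT'S INSTANCE of Proposition 1's data**: step `k`, regions `Z ⊇ Λ`, cube size `M`, THE FUNCTION (1.77)
`V_k ↦ A(U_{k,Z}(V_k))` = r11's `B15Sect1Instances.fun177std bg M₁ Z k` (r12's `fun177` at `U_{k,Z} = U(𝐁_k(Z), M˙(Q_k^{s*}·))`,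
(1.74)), and the carried analytic-extension clause `An`. [cite: Balaban1989LargeFieldI, (1.77) p.194] -/
def Inst.std (Z Λ : Set (Site P 0)) (k : ℕ) (M : ℝ) (An : ℝ → GaugeField P k G → Prop) : Inst P G :=
  ⟨k, Z, Λ, M, fun177std bg M₁ Z k, An⟩

/-- The function of print's instance is `fun177std` (definitional). [cite: Balaban1989LargeFieldI, (1.77) p.194] -/
@[simp] theorem Inst.std_f (Z Λ : Set (Site P 0)) (k : ℕ) (M : ℝ) (An : ℝ → GaugeField P k G → Prop) :
    (Inst.std bg M₁ Z Λ k M An).f = fun177std bg M₁ Z k := rfl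

/-- At print's instance *"a minimum of the function"* IS r11's `IsVLambdaStd bg M₁ Z Λ k V_k V_Λ` (definitional).
[cite: Balaban1989LargeFieldI, Prop. 1 (1.78) p.194] -/
theorem isMinPt_std_iff (Z Λ : Set (Site P 0)) (k : ℕ) (Vk VΛ : GaugeField P k G) :
    IsMinPt (bondsOf (pts k Λ)) (fun177std bg M₁ Z k) Vk VΛ ↔ IsVLambdaStd bg M₁ Z Λ k Vk VΛ := Iff.rfl

/-- At print's instance the function (1.77) is invariant under the gauge transformations defined on `Λ^{(k)}` — indeed under all
of `T^{(k)}`'s, r11's `fun177_gaugeAct` — over the [15] (181) covariance `Cov181` of the solution map (`k` in the `Params` range).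
[cite: Balaban1989LargeFieldI, (1.77) p.194] -/
theorem std_f_gaugeAct {Z : Set (Site P 0)} {k : ℕ} (hk : k ≤ P.m + P.K)
    (h181 : ∀ u : GaugeTransf P k G, Cov181 bg (Bj M₁ Z k) (blockLift k u)) (Λ : Set (Site P 0)) (M : ℝ)
    (An : ℝ → GaugeField P k G → Prop) (u : GaugeTransf P k G) (_hu : IsGaugeOn (pts k Λ) u) (V : GaugeField P k G) :
    (Inst.std bg M₁ Z Λ k M An).f (gaugeAct u V) = (Inst.std bg M₁ Z Λ k M An).f V :=
  fun177_gaugeAct bg M₁ hk u (h181 u) V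

/-- At print's instance a minimum stays a minimum along its Λ-orbit (r11's `isVLambda_gaugeAct`, over (181)).
[cite: Balaban1989LargeFieldI, Prop. 1 (1.78) p.194] -/
theorem IsMinPt.std_gaugeAct {Z Λ : Set (Site P 0)} {k : ℕ} (hk : k ≤ P.m + P.K) {u : GaugeTransf P k G}
    (hu : IsGaugeOn (pts k Λ) u) (h181 : Cov181 bg (Bj M₁ Z k) (blockLift k u)) {Vk VΛ : GaugeField P k G}
    (h : IsMinPt (bondsOf (pts k Λ)) (fun177std bg M₁ Z k) Vk VΛ) :
    IsMinPt (bondsOf (pts k Λ)) (fun177std bg M₁ Z k) Vk (GaugeField.gaugeAct u VΛ) :=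
  isVLambda_gaugeAct bg M₁ hk hu h181 h

/-- At print's instance, over (181): the `IsMinimum` conjunct of the carrier (*"An element of the orbit is a minimum"*) holds iff
EVERY element of the orbit is a minimum — the *"minimal orbit"* of p. 194. [cite: Balaban1989LargeFieldI, Prop. 1 p.194] -/
theorem isMinimum_std_iff_forall (ch : ExpChart G 𝔤) {ι : Type} {Z Λ : ι → Set (Site P 0)} {k : ι → ℕ} {M : ι → ℝ}
    {An : (i : ι) → ℝ → GaugeField P (k i) G → Prop} (hk : ∀ i, k i ≤ P.m + P.K)
    (h181 : ∀ i (u : GaugeTransf P (k i) G), Cov181 bg (Bj M₁ (Z i) (k i)) (blockLift (k i) u)) (i : ι)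
    (Vk : GaugeField P (k i) G) (O : OrbitSp G (pts (k i) (Λ i))) :
    (lfVar ch (fun i => Inst.std bg M₁ (Z i) (Λ i) (k i) (M i) (An i))).IsMinimum i Vk O ↔
      ∀ V ∈ O.1, IsMinPt (bondsOf (pts (k i) (Λ i))) (fun177std bg M₁ (Z i) (k i)) Vk V :=
  exists_isMinPt_iff_forall (fun u hu V => std_f_gaugeAct bg M₁ (hk i) (h181 i) (Λ i) (M i) (An i) u hu V) O

end Std

/-! ## §10 (v1.1, append-only) THE DOMAIN OF (1.77): minima over a set of configurations, print's example domain -/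

section Domain

variable {G : Type*} {k : ℕ}

/-- **MINIMUM of a function over a SET `X` of configurations**: `V ∈ X` and `f V ≤ f W` for every `W ∈ X` — print's *"a minimum of
the function"* (p. 194) with the function's DOMAIN made explicit (*"It is defined on configurations V_k satisfying mild regularity
conditions, e.g., |∂V_k − 1| < a₁ on Z"*): `X` = the variables `extSet Λb V_k` ∩ the domain. [cite: Balaban1989LargeFieldI, (1.77) p.194] -/
def IsMinPtOn (X : Set (GaugeField P k G)) (f : GaugeField P k G → ℝ) (V : GaugeField P k G) : Prop :=
  V ∈ X ∧ ∀ W ∈ X, f V ≤ f W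

/-- v1's `IsMinPt Λb f V_k V` is `IsMinPtOn` over ALL the variables (the `dom = ⊤` reading; definitional).
[cite: Balaban1989LargeFieldI, Prop. 1 p.194] -/
theorem isMinPt_iff_isMinPtOn (Λb : Set (PBond P k)) (f : GaugeField P k G → ℝ) (Vk V : GaugeField P k G) :
    IsMinPt Λb f Vk V ↔ IsMinPtOn (extSet Λb Vk) f V := Iff.rfl

/-- A minimum over `X` lying in `Y ⊆ X` is a minimum over `Y`. [cite: Balaban1989LargeFieldI, Prop. 1 p.194] -/
theorem IsMinPtOn.of_subset {X Y : Set (GaugeField P k G)} {f : GaugeField P k G → ℝ} {V : GaugeField P k G}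
    (h : IsMinPtOn X f V) (hYX : Y ⊆ X) (hV : V ∈ Y) : IsMinPtOn Y f V :=
  ⟨hV, fun W hW => h.2 W (hYX hW)⟩

variable [GaugeGroup G]

/-- **PRINT'S EXAMPLE DOMAIN of (1.77)**, p. 194 verbatim: *"It is defined on configurations V_k satisfying mild regularity
conditions, e.g., |∂V_k − 1| < a₁ on Z"* — the configurations of `T^{(k)}` with `|V(∂p) − 1| < a₁` for the plaquettes `p ⊂ Z^{(k)}`
(`plaqsInside`, the way p. 193 writes a regularity condition on a domain: *"for p′ ⊂ Z ∩ Λᶜ"*; a plaquette `p ⊂ Z` either meets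
`Λ` — then (1.78) speaks about it — or lies inside `Z ∩ Λᶜ` — then the hypothesis of Proposition 1 does); `a₁` is print's
letter (no value printed). [cite: Balaban1989LargeFieldI, (1.77) p.194] -/
def domReg (Z : Set (Site P 0)) (k : ℕ) (a₁ : ℝ) : Set (GaugeField P k G) := {V | PlaqSmallOn (plaqsInside (pts k Z)) a₁ V}

/-- Membership in `domReg`, unfolded. [cite: Balaban1989LargeFieldI, (1.77) p.194] -/
theorem mem_domReg_iff {Z : Set (Site P 0)} {a₁ : ℝ} {V : GaugeField P k G} :
    V ∈ domReg Z k a₁ ↔ PlaqSmallOn (plaqsInside (pts k Z)) a₁ V := Iff.rfl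

/-- A plaquette `p ⊂ Z^{(k)}` not meeting `Λ^{(k)}` lies inside `(Z ∩ Λᶜ)^{(k)}` — so on the example domain every plaquette is
governed either by (1.78) (`p ∈ Λ`) or by the hypothesis of Proposition 1 (`p ⊂ Z ∩ Λᶜ`). [cite: Balaban1989LargeFieldI, Prop. 1 p.194] -/
theorem mem_plaqsInside_inter_compl_of_not_mem {Z Λ : Set (Site P 0)} {p : Plaq P k} (hZ : p ∈ plaqsInside (pts k Z))
    (hΛ : p ∉ plaqsOf (pts k Λ)) : p ∈ plaqsInside (pts k (Z ∩ Λᶜ)) := by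
  rw [pts_inter_compl, mem_plaqsInside_inter_iff]
  exact ⟨hZ, mem_plaqsInside_compl_iff.2 hΛ⟩

/-- The example domain is invariant under EVERY gauge transformation (`|V^u(∂p) − 1| = |V(∂p) − 1|`) — in particular under those
defined on `Λ^{(k)}`, so (1.77) *"on orbits of this group"* makes sense on it. [cite: Balaban1989LargeFieldI, (1.77) p.194] -/
theorem gaugeAct_mem_domReg {Z : Set (Site P 0)} {a₁ : ℝ} (u : GaugeTransf P k G) {V : GaugeField P k G}
    (hV : V ∈ domReg Z k a₁) : GaugeField.gaugeAct u V ∈ domReg Z k a₁ :=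
  fun p hp => by rw [dist1_plaqHol_gaugeAct]; exact hV p hp

/-- Orbits through the example domain stay inside it. [cite: Balaban1989LargeFieldI, (1.77) p.194] -/
theorem orbit_subset_domReg {S : Set (Site P k)} {Z : Set (Site P 0)} {a₁ : ℝ} {V : GaugeField P k G} (hV : V ∈ domReg Z k a₁) :
    orbit S V ⊆ domReg Z k a₁ := by
  rintro W ⟨u, -, rfl⟩
  exact gaugeAct_mem_domReg u hV

/-- Minimality over (variables ∩ a Λ-invariant domain) passes along Λ-orbits of an invariant function.
[cite: Balaban1989LargeFieldI, Prop. 1 p.194] -/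
theorem IsMinPtOn.gaugeAct_inter {Λ : Set (Site P 0)} {f : GaugeField P k G → ℝ}
    (hf : ∀ u : GaugeTransf P k G, IsGaugeOn (pts k Λ) u → ∀ V, f (GaugeField.gaugeAct u V) = f V)
    {D : Set (GaugeField P k G)} (hD : ∀ u : GaugeTransf P k G, IsGaugeOn (pts k Λ) u → ∀ V ∈ D, GaugeField.gaugeAct u V ∈ D)
    {u : GaugeTransf P k G} (hu : IsGaugeOn (pts k Λ) u) {Vk V : GaugeField P k G}
    (h : IsMinPtOn (extSet (bondsOf (pts k Λ)) Vk ∩ D) f V) :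
    IsMinPtOn (extSet (bondsOf (pts k Λ)) Vk ∩ D) f (GaugeField.gaugeAct u V) :=
  ⟨⟨gaugeAct_mem_extSet hu h.1.1, hD u hu V h.1.2⟩, fun W hW => by rw [hf u hu V]; exact h.2 W hW⟩

/-- On a Λ-orbit, for an invariant function and a Λ-invariant domain: SOME element is a minimum over (variables ∩ domain) iff
EVERY element is. [cite: Balaban1989LargeFieldI, Prop. 1 p.194] -/
theorem exists_isMinPtOn_iff_forall {Λ : Set (Site P 0)} {f : GaugeField P k G → ℝ}
    (hf : ∀ u : GaugeTransf P k G, IsGaugeOn (pts k Λ) u → ∀ V, f (GaugeField.gaugeAct u V) = f V)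
    {D : Set (GaugeField P k G)} (hD : ∀ u : GaugeTransf P k G, IsGaugeOn (pts k Λ) u → ∀ V ∈ D, GaugeField.gaugeAct u V ∈ D)
    {Vk : GaugeField P k G} (O : OrbitSp G (pts k Λ)) :
    (∃ V ∈ O.1, IsMinPtOn (extSet (bondsOf (pts k Λ)) Vk ∩ D) f V) ↔
      ∀ V ∈ O.1, IsMinPtOn (extSet (bondsOf (pts k Λ)) Vk ∩ D) f V := by
  refine ⟨fun ⟨V, hV, hmin⟩ W hW => ?_, fun h => ?_⟩
  · have hWV : W ∈ orbit (pts k Λ) V := by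
      rw [← orbitOf_val, OrbitSp.orbitOf_eq_of_mem hV]; exact hW
    obtain ⟨u, hu, rfl⟩ := hWV
    exact hmin.gaugeAct_inter hf hD hu
  · obtain ⟨V, hV⟩ := O.nonempty
    exact ⟨V, hV, h V hV⟩

end Domain

/-! ## §11 (v1.1, append-only) THE CARRIER OF RECORD `lfVarOn`: critical orbit and minimum WITHIN THE DOMAIN of (1.77) -/

section CarrierOn

/-- **AN INSTANCE OF PROPOSITION 1 WITH THE DOMAIN OF (1.77)**: the data of `Inst` (step `k`, regions `Z ⊇ Λ`, cube size `M`, the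
function `f`, the carried analytic-extension clause `An`) PLUS the DOMAIN `dom` of the function (p. 194 *"It is defined on
configurations V_k satisfying mild regularity conditions, e.g., |∂V_k − 1| < a₁ on Z"*; print's example: `domReg Z k a₁`, at
`InstOn.std`). [cite: Balaban1989LargeFieldI, (1.77)–(1.78) p.194] -/
structure InstOn (P : Params) (G : Type) extends Inst P G where
  /-- the domain of the function (1.77): *"configurations V_k satisfying mild regularity conditions, e.g., |∂V_k − 1| < a₁ on Z"* -/
  dom : Set (GaugeField P k G)

variable {G : Type} [GaugeGroup G] {𝔤 : Type*} [AddCommGroup 𝔤] [Module ℝ 𝔤]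

/-- **THE CARRIER OF PROPOSITION 1 AS PRINTED — READING OF RECORD (with the domain of (1.77))**: as `lfVar`, except that a
CRITICAL ORBIT at the datum `V_k` is an orbit lying in the variables `extSet` ∩ THE DOMAIN `dom` and containing a critical
configuration, and *"a minimum of the function"* is a minimum over `extSet ∩ dom` (`IsMinPtOn`).  So *"exactly one critical orbit
of the function (1.77)"* ranges over the orbits in the function's domain, as printed. [cite: Balaban1989LargeFieldI, Prop. 1 (1.77)–(1.78) p.194] -/
def lfVarOn (ch : ExpChart G 𝔤) {ι : Type} (I : ι → InstOn P G) : B15.LFVar where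
  Inst := ι
  M i := (I i).M
  Bdry i := GaugeField P (I i).k G
  Orbit i := OrbitSp G (pts (I i).k (I i).Λ)
  Regular i ε Vk := PlaqSmallOn (plaqsInside (pts (I i).k ((I i).Z ∩ ((I i).Λ)ᶜ))) ε Vk
  IsCritical i Vk O :=
    O.1 ⊆ extSet (bondsOf (pts (I i).k (I i).Λ)) Vk ∩ (I i).dom ∧
      ∃ V ∈ O.1, IsCriticalPt ch (bondsOf (pts (I i).k (I i).Λ)) (I i).f V
  IsMinimum i Vk O := ∃ V ∈ O.1, IsMinPtOn (extSet (bondsOf (pts (I i).k (I i).Λ)) Vk ∩ (I i).dom) (I i).f V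
  dev i O := orbitDev (plaqsOf (pts (I i).k (I i).Λ)) O.1
  AnalyticExt i ε Vk := (I i).An ε Vk

/-- **PROPOSITION 1 [IV] AS PRINTED, AT THE LATTICE CARRIER OF RECORD** — `B15.Prop1Printed (lfVarOn ch I)` UNFOLDED
(definitional): *there is `B₅ > 0` such that for every instance `i` there is `e0 > 0` such that for all `0 < ε ≤ e0` and every
configuration `V_k` with `|V_k(∂p′) − 1| < ε` for all `p′ ⊂ (Z ∩ Λᶜ)^{(k)}`, there is an orbit `O` of the gauge transformations
defined on `Λ^{(k)}`, lying in (the configurations equal to `V_k` off the bonds meeting `Λ^{(k)}`) ∩ (the domain of (1.77)) and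
containing a critical configuration of the function, which is the ONLY such orbit, which contains a minimum of the function over
that set, whose deviation `sup_{V∈O, p′∈Λ} |V(∂p′) − 1|` is `< B₅M⁵ε`, and the analytic-extension clause holds at `(ε, V_k)`.*
NOT asserted — the sentence to be inhabited at NODE 00's objects. [cite: Balaban1989LargeFieldI, Prop. 1 (1.78) p.194] -/
theorem prop1Printed_lfVarOn_iff (ch : ExpChart G 𝔤) {ι : Type} (I : ι → InstOn P G) :
    B15.Prop1Printed (lfVarOn ch I) ↔
      ∃ B₅ : ℝ, 0 < B₅ ∧ ∀ i : ι, ∃ e0 : ℝ, 0 < e0 ∧ ∀ ε : ℝ, 0 < ε → ε ≤ e0 →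
        ∀ Vk : GaugeField P (I i).k G, PlaqSmallOn (plaqsInside (pts (I i).k ((I i).Z ∩ ((I i).Λ)ᶜ))) ε Vk →
          ∃ O : OrbitSp G (pts (I i).k (I i).Λ),
            (O.1 ⊆ extSet (bondsOf (pts (I i).k (I i).Λ)) Vk ∩ (I i).dom ∧
                ∃ V ∈ O.1, IsCriticalPt ch (bondsOf (pts (I i).k (I i).Λ)) (I i).f V) ∧
              (∀ O' : OrbitSp G (pts (I i).k (I i).Λ),
                (O'.1 ⊆ extSet (bondsOf (pts (I i).k (I i).Λ)) Vk ∩ (I i).dom ∧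
                    ∃ V ∈ O'.1, IsCriticalPt ch (bondsOf (pts (I i).k (I i).Λ)) (I i).f V) → O' = O) ∧
              (∃ V ∈ O.1, IsMinPtOn (extSet (bondsOf (pts (I i).k (I i).Λ)) Vk ∩ (I i).dom) (I i).f V) ∧
              orbitDev (plaqsOf (pts (I i).k (I i).Λ)) O.1 < B₅ * (I i).M ^ 5 * ε ∧ (I i).An ε Vk :=
  Iff.rfl

/-- **(1.78) FOR THE ELEMENT `V_Λ`, reading of record**: from Proposition 1 at `lfVarOn`, every regular datum `V_k` below the threshold
has a minimiser `V_Λ` of (1.77) over (the configurations equal to `V_k` off `Λ`) ∩ (the domain), with `|V_Λ(∂p′) − 1| < B₅M⁵ε` for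
every plaquette `p′` meeting `Λ^{(k)}`. [cite: Balaban1989LargeFieldI, Prop. 1 (1.78) p.194] -/
theorem exists_minimizerOn_of_prop1Printed (ch : ExpChart G 𝔤) {ι : Type} {I : ι → InstOn P G}
    (h : B15.Prop1Printed (lfVarOn ch I)) :
    ∃ B₅ : ℝ, 0 < B₅ ∧ ∀ i : ι, ∃ e0 : ℝ, 0 < e0 ∧ ∀ ε : ℝ, 0 < ε → ε ≤ e0 →
      ∀ Vk : GaugeField P (I i).k G, PlaqSmallOn (plaqsInside (pts (I i).k ((I i).Z ∩ ((I i).Λ)ᶜ))) ε Vk →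
        ∃ VΛ : GaugeField P (I i).k G,
          IsMinPtOn (extSet (bondsOf (pts (I i).k (I i).Λ)) Vk ∩ (I i).dom) (I i).f VΛ ∧
            ∀ p ∈ plaqsOf (pts (I i).k (I i).Λ), dist1 (plaqHol VΛ p) < B₅ * (I i).M ^ 5 * ε := by
  obtain ⟨B₅, hB₅, hall⟩ := (prop1Printed_lfVarOn_iff ch I).1 h
  refine ⟨B₅, hB₅, fun i => ?_⟩
  obtain ⟨e0, he0, hε⟩ := hall i
  refine ⟨e0, he0, fun ε hεpos hεle Vk hreg => ?_⟩
  obtain ⟨O, -, -, ⟨V, hV, hmin⟩, hdev, -⟩ := hε ε hεpos hεle Vk hreg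
  exact ⟨V, hmin, fun p hp => dist1_lt_of_orbitDev_lt O.2 hdev hV hp⟩

/-- The `dev` conjunct at `lfVarOn` from (1.78) at ONE element of the orbit (`0 < c`). [cite: Balaban1989LargeFieldI, Prop. 1 (1.78) p.194] -/
theorem devOn_lt_of_mem (ch : ExpChart G 𝔤) {ι : Type} (I : ι → InstOn P G) (i : ι) (O : (lfVarOn ch I).Orbit i)
    {V : GaugeField P (I i).k G} (hV : V ∈ O.1) {c : ℝ} (hc : 0 < c)
    (h : ∀ p ∈ plaqsOf (pts (I i).k (I i).Λ), dist1 (plaqHol V p) < c) : (lfVarOn ch I).dev i O < c := by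
  obtain ⟨V₀, hO⟩ := O.exists_eq_orbitOf
  subst hO
  show orbitDev (plaqsOf (pts (I i).k (I i).Λ)) (orbit (pts (I i).k (I i).Λ) V₀) < c
  have hV' : V ∈ orbit (pts (I i).k (I i).Λ) V₀ := hV
  rw [← orbit_eq_of_mem hV']
  exact orbitDev_orbit_lt hc h

/-- The `Regular` hypothesis of `lfVarOn` reads the datum off `Λ` only. [cite: Balaban1989LargeFieldI, Prop. 1 p.194] -/
theorem regularOn_congr (ch : ExpChart G 𝔤) {ι : Type} (I : ι → InstOn P G) (i : ι) {ε : ℝ} {Vk Vk' : GaugeField P (I i).k G}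
    (hVk : ∀ b, b ∉ bondsOf (pts (I i).k (I i).Λ) → Vk b = Vk' b) :
    (lfVarOn ch I).Regular i ε Vk ↔ (lfVarOn ch I).Regular i ε Vk' :=
  plaqSmallOn_inside_congr hVk

/-- A critical orbit in the sense of `lfVarOn` is one in the sense of v1's `lfVar` (the domain clause dropped).
[cite: Balaban1989LargeFieldI, Prop. 1 p.194] -/
theorem isCritical_lfVar_of_lfVarOn (ch : ExpChart G 𝔤) {ι : Type} (I : ι → InstOn P G) (i : ι)
    (Vk : GaugeField P (I i).k G) (O : OrbitSp G (pts (I i).k (I i).Λ)) (h : (lfVarOn ch I).IsCritical i Vk O) :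
    (lfVar ch fun j => (I j).toInst).IsCritical i Vk O :=
  ⟨fun _ hV => (h.1 hV).1, h.2⟩

variable {av : ∀ j, Averaging P j G} (bg : DetBackground P G av) (M₁ : ℕ)

/-- **PRINT'S INSTANCE WITH ITS EXAMPLE DOMAIN**: `Inst.std bg M₁ Z Λ k M An` (the function (1.77) = `fun177std bg M₁ Z k`) with
`dom := domReg Z k a₁` (*"|∂V_k − 1| < a₁ on Z"*). [cite: Balaban1989LargeFieldI, (1.77) p.194] -/
def InstOn.std (Z Λ : Set (Site P 0)) (k : ℕ) (M a₁ : ℝ) (An : ℝ → GaugeField P k G → Prop) : InstOn P G :=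
  ⟨Inst.std bg M₁ Z Λ k M An, domReg Z k a₁⟩

/-- The function of print's instance with domain is `fun177std` (definitional). [cite: Balaban1989LargeFieldI, (1.77) p.194] -/
@[simp] theorem InstOn.std_f (Z Λ : Set (Site P 0)) (k : ℕ) (M a₁ : ℝ) (An : ℝ → GaugeField P k G → Prop) :
    (InstOn.std bg M₁ Z Λ k M a₁ An).f = fun177std bg M₁ Z k := rfl

/-- Its domain is `domReg Z k a₁` (definitional). [cite: Balaban1989LargeFieldI, (1.77) p.194] -/
@[simp] theorem InstOn.std_dom (Z Λ : Set (Site P 0)) (k : ℕ) (M a₁ : ℝ) (An : ℝ → GaugeField P k G → Prop) :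
    (InstOn.std bg M₁ Z Λ k M a₁ An).dom = domReg Z k a₁ := rfl

/-- At print's instance with its example domain, over the [15] (181) covariance: the `IsMinimum` conjunct of the carrier of record
(*"An element of the orbit is a minimum of the function"*) holds iff EVERY element of the orbit is a minimum over
(variables ∩ domain) — the *"minimal orbit"* of p. 194. [cite: Balaban1989LargeFieldI, Prop. 1 p.194] -/
theorem isMinimumOn_std_iff_forall (ch : ExpChart G 𝔤) {ι : Type} {Z Λ : ι → Set (Site P 0)} {k : ι → ℕ} {M a₁ : ι → ℝ}
    {An : (i : ι) → ℝ → GaugeField P (k i) G → Prop} (hk : ∀ i, k i ≤ P.m + P.K)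
    (h181 : ∀ i (u : GaugeTransf P (k i) G), Cov181 bg (Bj M₁ (Z i) (k i)) (blockLift (k i) u)) (i : ι)
    (Vk : GaugeField P (k i) G) (O : OrbitSp G (pts (k i) (Λ i))) :
    (lfVarOn ch (fun i => InstOn.std bg M₁ (Z i) (Λ i) (k i) (M i) (a₁ i) (An i))).IsMinimum i Vk O ↔
      ∀ V ∈ O.1, IsMinPtOn (extSet (bondsOf (pts (k i) (Λ i))) Vk ∩ domReg (Z i) (k i) (a₁ i))
        (fun177std bg M₁ (Z i) (k i)) V :=
  exists_isMinPtOn_iff_forall (fun u hu V => std_f_gaugeAct bg M₁ (hk i) (h181 i) (Λ i) (M i) (An i) u hu V)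
    (fun u _ _ hV => gaugeAct_mem_domReg u hV) O

end CarrierOn

/-! ## §12 (v1.1, append-only) Junction with r13's chart criticality `B16Sect1AnalyticExt.ExtData.IsCritAt` -/

section CriticalJunction

variable {G : Type*} [GaugeGroup G] {𝔤 : Type*} [AddCommGroup 𝔤] [Module ℝ 𝔤] (ch : ExpChart G 𝔤) {k : ℕ}

/-- r13's criticality *along every chart direction* (`B16Sect1AnalyticExt.ExtData.IsCritAt f V′ := ∀ δB, HasDerivAt (t ↦
f((exp itδB)·V′)) 0 0`, [LF-II] (1.39) p. 366, stated on the two-slot carrier where the variable lives on `Λ` by construction)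
implies criticality in the directions supported on `Λb` — the two typings of *"critical"* agree where both apply (stated here
without importing r13's module: the hypothesis is `IsCritAt` unfolded). [cite: Balaban1989LargeFieldII, (1.12) p.359, (1.39) p.366] -/
theorem isCriticalPt_of_forall_hasDerivAt {Λb : Set (PBond P k)} {f : GaugeField P k G → ℝ} {V : GaugeField P k G}
    (h : ∀ A : VecField P k 𝔤, HasDerivAt (fun s : ℝ => f (expMul ch (s • A) V)) 0 0) : IsCriticalPt ch Λb f V :=
  fun A _ => h A

end CriticalJunction

end Literature.MathematicalPhysics.QuantumFieldTheory.Balaban1983to89.B15Prop1Carrier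

end
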